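import Summits.KontsevichZagierPeriods.KontsevichZagierPeriods.Theorems.StandardPartsSpArcLiftingRawArcs
import Summits.KontsevichZagierPeriods.KontsevichZagierPeriods.Theorems.StandardPartsSpArcClosure

/-!
# Route StandardParts — `SpArcLifting` (stmt-KontsevichZagierPeriods-3155) IS the summit, unconditionally

Problem `KontsevichZagierPeriods`, route `StandardParts`, crux item stmt-KontsevichZagierPeriods-3155
(`SpArcLifting`). Helper file (`--supports`) of the line `registered` (`Cruxes/SpArcLifting/Lines/birth.lean`),
lead c2.

Now that the typed closure half `SpArcClosure` (item 3153) has landed (`SpArcClosure_proof`,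
`Theorems/StandardPartsSpArcClosure.lean`: `IntegralRep`-valued `ℚ`-semialgebraic arcs are eventually
constant at `0⁺`), the conditional certificate `summit_iff_spArcLifting_of_spArcClosure` of
`Theorems/StandardPartsSpArcLiftingRawArcs.lean` becomes unconditional:

* `spArcLifting_iff_summit` — `SpArcLifting ↔ KontsevichZagierPeriods`. The crux AS TYPED is literally
  Conjecture 1: it can be neither proved nor refuted short of settling the summit, and every skeleton of
  it is a skeleton of the period conjecture.
* `spArcLifting_iff_rawArcs` — hence `SpArcLifting ↔ (raw closure ∧ raw lifting)`, the two registered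
  stubs `stub_rawArcClosure`, `stub_rawArcLifting` of the line (via `summit_iff_rawArcs`): the line's
  composition is not only sufficient but necessary.
* `value_eq_of_rawArcs` — the transcendence-free SHADOW of `stub_rawArcClosure`, proved outright: raw
  `ℚ`-semialgebraic arcs with integrable fibres on `(0,1)` whose rational fibres are arcs of identities
  and which converge in `L¹` to `r₀`, `r₀'` have `r₀.value = r₀'.value`. So `stub_rawArcClosure` admits
  no value-level counterexample; what it asserts beyond this theorem is exactly `KZ.Equivalent` of an
  equal-valued endpoint pair, i.e. summit-strength information (`rawArcClosure_of_value_eq`).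
* `rawArcs_of_equivalent` — the unconditional core of `rawArcLifting_of_summit`: a `KZ.Equivalent` pair
  lifts to a raw arc of identities (constant raw families); so `stub_rawArcLifting` holds at every pair
  already known to be equivalent, and carries content only at pairs where Conjecture 1 is open.

Sources: M. Kontsevich, D. Zagier, *Periods* (2001), §1.2 Conjecture 1 [KontsevichZagier2001];
L. van den Dries, *Tame topology and o-minimal structures* (1998), Ch. 3 (3.1) [Dries1998].
-/

noncomputable section

namespace Summit.KontsevichZagierPeriods.StandardParts

open Filter Set MeasureTheory Topology
open Literature.NumberTheory.Transcendental
open Summit.KontsevichZagierPeriods.KontsevichZagierPeriods.Theses.StandardParts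
  (SpArcLifting SpArcClosure closes)

variable {n m : ℕ}

/-! ### The typed crux is the summit -/

/-- **`SpArcLifting ↔ KontsevichZagierPeriods`, unconditionally.** Forward: the route's deciding theorem
`closes` with the landed `SpArcClosure_proof` (item 3153); backward: constant arcs
(`spArcLifting_of_summit`). Item stmt-KontsevichZagierPeriods-3155 as typed is Conjecture 1 itself.
[cite: KontsevichZagier2001, §1.2 Conjecture 1] -/
theorem spArcLifting_iff_summit : SpArcLifting ↔ KontsevichZagierPeriods :=
  (summit_iff_spArcLifting_of_spArcClosure SpArcClosure_proof).symm

/-- **The typed crux is equivalent to the conjunction of the two registered stubs** of the line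
`registered` (`stub_rawArcClosure ∧ stub_rawArcLifting`, signatures verbatim): the line's composition
`summit_of_rawArcs` is necessary as well as sufficient. [cite: KontsevichZagier2001, §1.2 Conjecture 1] -/
theorem spArcLifting_iff_rawArcs :
    SpArcLifting ↔
      ((∀ ⦃n m : ℕ⦄ (S : KZ.RawFamily n) (S' : KZ.RawFamily m)
        (r₀ : KZ.IntegralRep n) (r₀' : KZ.IntegralRep m),
        (∀ t ∈ Set.Ioo (0:ℝ) 1, IntegrableOn (S.fibreFun t) (S.fibre t)) →
        (∀ t ∈ Set.Ioo (0:ℝ) 1, IntegrableOn (S'.fibreFun t) (S'.fibre t)) →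
        (∀ q : ℚ, (q : ℝ) ∈ Set.Ioo (0:ℝ) 1 → ∀ (ρ : KZ.IntegralRep n) (ρ' : KZ.IntegralRep m),
          ρ.domain = S.fibre q → Set.EqOn ρ.integrand (S.fibreFun q) (S.fibre q) →
          ρ'.domain = S'.fibre q → Set.EqOn ρ'.integrand (S'.fibreFun q) (S'.fibre q) →
          KZ.Equivalent ρ ρ') →
        S.HasL1Limit r₀ → S'.HasL1Limit r₀' → KZ.Equivalent r₀ r₀') ∧
      (∀ ⦃n m : ℕ⦄ (r : KZ.IntegralRep n) (r' : KZ.IntegralRep m),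
        r.IsRational → r'.IsRational → r.value = r'.value →
        ∃ (S : KZ.RawFamily n) (S' : KZ.RawFamily m),
          (∀ t ∈ Set.Ioo (0:ℝ) 1, IntegrableOn (S.fibreFun t) (S.fibre t)) ∧
          (∀ t ∈ Set.Ioo (0:ℝ) 1, IntegrableOn (S'.fibreFun t) (S'.fibre t)) ∧
          (∀ q : ℚ, (q : ℝ) ∈ Set.Ioo (0:ℝ) 1 → ∀ (ρ : KZ.IntegralRep n) (ρ' : KZ.IntegralRep m),
            ρ.domain = S.fibre q → Set.EqOn ρ.integrand (S.fibreFun q) (S.fibre q) →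
            ρ'.domain = S'.fibre q → Set.EqOn ρ'.integrand (S'.fibreFun q) (S'.fibre q) →
            KZ.Equivalent ρ ρ') ∧
          S.HasL1Limit r ∧ S'.HasL1Limit r')) :=
  spArcLifting_iff_summit.trans summit_iff_rawArcs

/-! ### The value-level shadow of raw closure, proved outright -/

/-- **Raw arcs of identities have equal-valued `L¹`-endpoints** (the transcendence-free shadow of the
stub `stub_rawArcClosure`, unconditional). At a rational `q ∈ (0,1)` the two fibres are realised by
integral representations (`exists_integralRep_rawFamily_fibre`), `KZ.Equivalent` by hypothesis, hence
of equal value (`KZ.Equivalent.value_eq_holds`); `L¹`-convergence gives convergence of the fibre values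
to `r₀.value`, `r₀'.value` (`tendsto_integral_indicator_fibre`); along the rational sequence
`1/(k+1) → 0⁺` the two sequences coincide, so the limits agree. Consequently `stub_rawArcClosure` has
no value-level counterexample: what it asserts beyond this theorem is `KZ.Equivalent` of an
equal-valued pair. [cite: KontsevichZagier2001, §1.2] -/
theorem value_eq_of_rawArcs (S : KZ.RawFamily n) (S' : KZ.RawFamily m)
    (r₀ : KZ.IntegralRep n) (r₀' : KZ.IntegralRep m)
    (hi : ∀ t ∈ Set.Ioo (0:ℝ) 1, IntegrableOn (S.fibreFun t) (S.fibre t))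
    (hi' : ∀ t ∈ Set.Ioo (0:ℝ) 1, IntegrableOn (S'.fibreFun t) (S'.fibre t))
    (heq : ∀ q : ℚ, (q : ℝ) ∈ Set.Ioo (0:ℝ) 1 → ∀ (ρ : KZ.IntegralRep n) (ρ' : KZ.IntegralRep m),
      ρ.domain = S.fibre q → Set.EqOn ρ.integrand (S.fibreFun q) (S.fibre q) →
      ρ'.domain = S'.fibre q → Set.EqOn ρ'.integrand (S'.fibreFun q) (S'.fibre q) →
      KZ.Equivalent ρ ρ')
    (hl : S.HasL1Limit r₀) (hl' : S'.HasL1Limit r₀') : r₀.value = r₀'.value := by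
  have h₁ := (tendsto_integral_indicator_fibre S r₀ hi hl).comp tendsto_one_div_nat_succ_nhdsGT
  have h₂ := (tendsto_integral_indicator_fibre S' r₀' hi' hl').comp tendsto_one_div_nat_succ_nhdsGT
  refine tendsto_nhds_unique (h₁.congr' ?_) h₂
  filter_upwards [eventually_ge_atTop 1] with k hk
  have hk' : (1:ℝ) ≤ k := by exact_mod_cast hk
  have hq : (((1 / ((k:ℚ) + 1) : ℚ)) : ℝ) = (1:ℝ) / ((k:ℝ) + 1) := by push_cast; ring
  have hmem : (((1 / ((k:ℚ) + 1) : ℚ)) : ℝ) ∈ Set.Ioo (0:ℝ) 1 := by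
    rw [hq]
    constructor
    · positivity
    · rw [div_lt_one (by positivity)]
      linarith
  obtain ⟨ρ, hρd, hρf⟩ := exists_integralRep_rawFamily_fibre S _ (hi _ hmem)
  obtain ⟨ρ', hρ'd, hρ'f⟩ := exists_integralRep_rawFamily_fibre S' _ (hi' _ hmem)
  have hv : ρ.value = ρ'.value :=
    KZ.Equivalent.value_eq_holds
      (heq _ hmem ρ ρ' hρd (fun x _ => by rw [hρf]) hρ'd (fun x _ => by rw [hρ'f]))
  simp only [Function.comp_apply]
  rw [← hq, ← value_eq_integral_indicator_fibre S _ ρ hρd (fun x _ => by rw [hρf]),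
    ← value_eq_integral_indicator_fibre S' _ ρ' hρ'd (fun x _ => by rw [hρ'f]), hv]

/-- **Raw closure reduces to the summit's conclusion at its own endpoints**: to prove
`stub_rawArcClosure` for given data it suffices to know that THIS equal-valued endpoint pair
`(r₀, r₀')` is `KZ.Equivalent` — the arc hypotheses contribute exactly `r₀.value = r₀'.value`
(`value_eq_of_rawArcs`) and nothing a value cannot see. [cite: KontsevichZagier2001, §1.2] -/
theorem rawArcClosure_of_value_eq (S : KZ.RawFamily n) (S' : KZ.RawFamily m)
    (r₀ : KZ.IntegralRep n) (r₀' : KZ.IntegralRep m)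
    (hi : ∀ t ∈ Set.Ioo (0:ℝ) 1, IntegrableOn (S.fibreFun t) (S.fibre t))
    (hi' : ∀ t ∈ Set.Ioo (0:ℝ) 1, IntegrableOn (S'.fibreFun t) (S'.fibre t))
    (heq : ∀ q : ℚ, (q : ℝ) ∈ Set.Ioo (0:ℝ) 1 → ∀ (ρ : KZ.IntegralRep n) (ρ' : KZ.IntegralRep m),
      ρ.domain = S.fibre q → Set.EqOn ρ.integrand (S.fibreFun q) (S.fibre q) →
      ρ'.domain = S'.fibre q → Set.EqOn ρ'.integrand (S'.fibreFun q) (S'.fibre q) →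
      KZ.Equivalent ρ ρ')
    (hl : S.HasL1Limit r₀) (hl' : S'.HasL1Limit r₀')
    (h : r₀.value = r₀'.value → KZ.Equivalent r₀ r₀') : KZ.Equivalent r₀ r₀' :=
  h (value_eq_of_rawArcs S S' r₀ r₀' hi hi' heq hl hl')

/-! ### The unconditional core of raw lifting -/

/-- **Equivalent pairs lift to raw arcs of identities** (constant raw families; the unconditional core
of `rawArcLifting_of_summit`): for `r ~ r'` the constant families `KZ.RawFamily.const r`, `const r'`
have integrable fibres `(σ, f)`, `(σ', f')`, every realisation of which is congruent to `r`, `r'`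
(`KZ.of_sub_of_mem_relations_of_eqOn`), and converge to themselves (`hasL1Limit_const`). Hence the stub
`stub_rawArcLifting` holds at every pair already known to be `KZ.Equivalent`; its content lies entirely
at the pairs where Conjecture 1 is open. [cite: KontsevichZagier2001, §1.2 Conjecture 1] -/
theorem rawArcs_of_equivalent (r : KZ.IntegralRep n) (r' : KZ.IntegralRep m)
    (hrr' : KZ.Equivalent r r') :
    ∃ (S : KZ.RawFamily n) (S' : KZ.RawFamily m),
      (∀ t ∈ Set.Ioo (0:ℝ) 1, IntegrableOn (S.fibreFun t) (S.fibre t)) ∧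
      (∀ t ∈ Set.Ioo (0:ℝ) 1, IntegrableOn (S'.fibreFun t) (S'.fibre t)) ∧
      (∀ q : ℚ, (q : ℝ) ∈ Set.Ioo (0:ℝ) 1 → ∀ (ρ : KZ.IntegralRep n) (ρ' : KZ.IntegralRep m),
        ρ.domain = S.fibre q → Set.EqOn ρ.integrand (S.fibreFun q) (S.fibre q) →
        ρ'.domain = S'.fibre q → Set.EqOn ρ'.integrand (S'.fibreFun q) (S'.fibre q) →
        KZ.Equivalent ρ ρ') ∧
      S.HasL1Limit r ∧ S'.HasL1Limit r' := by
  refine ⟨KZ.RawFamily.const r, KZ.RawFamily.const r', ?_, ?_, ?_,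
    KZ.RawFamily.hasL1Limit_const r, KZ.RawFamily.hasL1Limit_const r'⟩
  · intro t _
    simpa only [KZ.RawFamily.fibre_const, KZ.RawFamily.fibreFun_const] using r.integrableOn
  · intro t _
    simpa only [KZ.RawFamily.fibre_const, KZ.RawFamily.fibreFun_const] using r'.integrableOn
  · intro q _ ρ ρ' hρd hρf hρ'd hρ'f
    simp only [KZ.RawFamily.fibre_const, KZ.RawFamily.fibreFun_const] at hρd hρf hρ'd hρ'f
    have e₁ : KZ.Equivalent ρ r :=
      KZ.of_sub_of_mem_relations_of_eqOn hρd.symm (by rw [hρd]; exact hρf)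
    have e₂ : KZ.Equivalent ρ' r' :=
      KZ.of_sub_of_mem_relations_of_eqOn hρ'd.symm (by rw [hρ'd]; exact hρ'f)
    exact e₁.trans (hrr'.trans e₂.symm)

end Summit.KontsevichZagierPeriods.StandardParts
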